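import Summits.HodgeConjecture.HodgeConjecture.Theses.PadicSemiregularLift
import Summits.HodgeConjecture.HodgeConjecture.Theorems.PadicSemiregularLiftHodgeAbelianVarietiesStarSeedsEngine
import Summits.HodgeConjecture.HodgeConjecture.Theorems.PadicSemiregularLiftAbelianAnchorAssemblyGlue
import Summits.HodgeConjecture.HodgeConjecture.Theorems.PadicSemiregularLiftFermatAnchorAssemblyDefs
import Literature.AlgebraicGeometry.Crystalline.PadicAnchorDefs
import Literature.AlgebraicGeometry.HodgeTheory.ComplexConjugationHolds

/-!
# `FermatAnchorAssembly` (stmt-HodgeConjecture-14874), line `Sketch`: the `∀`-anchor seed stub is unneeded strength — one ANCHORED seed statement suffices; tightness at the anchor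

Negative / hypothesis-mutation lemmas of the standing disprover for the picked line `Sketch`
(parallelizable-avatar) of the crux `FermatAnchorAssembly`, over the line's landed vocabulary
(`Theorems/PadicSemiregularLiftFermatAnchorAssemblyDefs.lean`: `HodgeFermatJacobianPowersAt`,
`HasGenuineSpanningAnchor`, `zeroOneSeedClasses`, `ZeroOneSeedsFor`, `ZeroOneSeedsAtAnchors`). All
sorry-free; the route items P1b/P1a/P3a enter only as named hypotheses; no route item is asserted.

* `hodgeConjectureFor_of_exists_anchored_zeroOneSeeds` — the line's composition consumes, per host, only
  `∃ D : Anchor n X, D.IsGenuine ∧ D.SpansHodge ∧ ZeroOneSeedsFor D.C n D.𝒴`; the registered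
  `stub_zeroOneSeeds` (`ZeroOneSeedsAtAnchors`: seeds at EVERY genuine anchor — every prime, every model,
  every exotic value of the hypothesis structure `CrystallineRealization` passing `IsGenuine`) together
  with `stub_anchors`' separate `∃` is strictly stronger (`exists_anchored_of_stubs`) than what is used;
* `hodgeFermatJacobianPowersAt_of_exists_anchored` — the merged `∃`-form at the hosts already yields the
  hypothesis of `stub_transfer` (HC for all powers of all Fermat Jacobians), granted the engine;
* `middleCyclePart_of_zeroOneSeedsFor` — TIGHTNESS transferred to this line: at a genuine spanning anchor
  the seeds + engine give exactly `MiddleCyclePart` of the host, while from HC of the host only the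
  CLASS-level `RationalPVHCFor` comes back (`PadicAnchor.Anchor.rationalPVHCFor_iff_middleCyclePart`,
  `AbelianAnchor.rationalPVHCFor_iff_hodgeConjectureFor`), never the object-level seed statement: the open
  stub is ≥ "HC in the middle degrees for every power of every Fermat Jacobian" and object-level on top;
* `rationalPVHCFor_of_seeds_mod_generic_algebraic` — seeds are only needed modulo classes whose
  Berthelot–Ogus image is already `K`-algebraic on the generic fibre (the registered stub asks seeds for
  ALL of `U_Hdg`).

Refuter refuter-cdisprove-stmt-HodgeConjecture-14874-0, 2026-08-16 (paper findings on the CM anchors —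
`SpansHodge`/B2 hold, no fake classes, first-order Hodge-locus no-go void on the hosts — in
`Cruxes/FermatAnchorAssembly/Disproof.lean`).
-/

-- `Summit.HodgeConjecture.HodgeConjecture.…` is the tree's mandated summit/problem namespace (single-problem summit).
set_option linter.dupNamespace false

noncomputable section

open CategoryTheory AlgebraicGeometry
open scoped Isocrystal
open Literature.AlgebraicGeometry Literature.AlgebraicGeometry.Motives
  Literature.AlgebraicGeometry.HodgeTheory Literature.AlgebraicGeometry.Crystalline
  Literature.AlgebraicGeometry.Crystalline.PadicAnchor Literature.AlgebraicGeometry.KTheory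
open Summit.HodgeConjecture.HodgeConjecture.Theses.PadicSemiregularLift
open Summit.HodgeConjecture.HodgeConjecture.Cruxes.HodgeAbelianVarieties.InnerFormInvariantSeeds.Engine
open Summit.HodgeConjecture.HodgeConjecture.Cruxes.FermatAnchorAssembly.ParallelizableAvatar
open Summit.HodgeConjecture.HodgeConjecture.Theorems.PadicSemiregularLift.AbelianAnchor
  (rationalPVHCFor_of_starSeedsFor cyclePart isSmoothProjective_of_padicModel)

namespace Summit.HodgeConjecture.HodgeConjecture.Theorems.FermatAnchorAssemblyNegative

section Seeds

variable {p : ℕ} [Fact p.Prime] {k : Type} [Field k] [CharP k p] [PerfectRing k p]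

/-- `{0,1}`-seed classes are (⋆)-seed classes granted P1b on the (smooth proper) model. [folklore] -/
theorem zeroOneSeedClasses_subset_starSeedClasses (h1b : PadicPridhamSemiregularity)
    (C : CrystallineRealization p k) {d : ℕ} {𝒴 : SchemeOver (WittVector p k)}
    (h𝒴 : WittScheme.IsSmoothProperModel d 𝒴) (r : ℕ) :
    zeroOneSeedClasses C 𝒴 r ⊆ starSeedClasses C 𝒴 r :=
  zeroOneSeedClasses_subset_starSeedClasses_of C (fun E hE hsr => h1b p k d 𝒴 h𝒴 E hE hsr) r

/-- `{0,1}`-seeds + P1b ⟹ (⋆)-seeds. [folklore] -/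
theorem starSeedsFor_of_zeroOneSeedsFor (h1b : PadicPridhamSemiregularity)
    (C : CrystallineRealization p k) {d : ℕ} {𝒴 : SchemeOver (WittVector p k)}
    (h𝒴 : WittScheme.IsSmoothProperModel d 𝒴) (h : ZeroOneSeedsFor C d 𝒴) : StarSeedsFor C d 𝒴 :=
  starSeedsFor_of_zeroOneSeedsFor_of C (fun E hE hsr => h1b p k d 𝒴 h𝒴 E hE hsr) h

/-- **Seeds are only needed modulo classes already `K`-algebraic on the generic fibre** (hypothesis
mutation): if every `u ∈ U_Hdg^r` is, up to `N ≠ 0`, a `{0,1}`-seed combination PLUS a class whose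
Berthelot–Ogus image lies in the `K`-span of algebraic classes of `Y_K`, the engine still returns
`RationalPVHCFor`. [folklore] -/
theorem rationalPVHCFor_of_seeds_mod_generic_algebraic (h1b : PadicPridhamSemiregularity)
    (h1a : FormalLiftingFromClassLifting) (h3a : FormalVectorBundlesAlgebraize)
    (C : CrystallineRealization p k) (hBEK : BlochEsnaultKerzLifting C) {d : ℕ}
    {𝒴 : SchemeOver (WittVector p k)} (hM : ModelHypotheses d 𝒴)
    (h : ∀ (r : ℕ), 1 ≤ r → r < d → ∀ u ∈ C.ratAlgebraicClasses (WittScheme.specialFibre 𝒴) r,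
      C.bo 𝒴 (2 * r) u ∈ C.dR.fil (2 * r) r →
      ∃ (N : ℤ) (s v : C.obj (WittScheme.specialFibre 𝒴) (2 * r)), N ≠ 0 ∧ N • u = s + v ∧
        s ∈ AddSubgroup.closure (zeroOneSeedClasses C 𝒴 r) ∧
        C.bo 𝒴 (2 * r) v ∈ Submodule.span K(p, k)
          (C.dR.ratAlgebraicClasses (WittScheme.genericFibre 𝒴) r :
            Set (C.dR.obj (WittScheme.genericFibre 𝒴) (2 * r)))) :
    RationalPVHCFor C d 𝒴 := by
  intro r h1 hr u hu hfil
  obtain ⟨N, s, v, hN, hNu, hs, hv⟩ := h r h1 hr u hu hfil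
  have hs' : (1 : ℤ) • s ∈ AddSubgroup.closure (starSeedClasses C 𝒴 r) := by
    rw [one_zsmul]
    exact AddSubgroup.closure_mono (zeroOneSeedClasses_subset_starSeedClasses h1b C hM.smoothProper r) hs
  have hbs := bo_mem_span_of_starSeedClasses h1a h3a C hBEK hM.smoothProper hM.projective hM.large
    hM.torsionFree_structureSheaf hM.torsionFree_hodgeOne hM.cotangent_free one_ne_zero hs'
  have hNbo : (N : K(p, k)) • C.bo 𝒴 (2 * r) u ∈ Submodule.span K(p, k)
      (C.dR.ratAlgebraicClasses (WittScheme.genericFibre 𝒴) r :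
        Set (C.dR.obj (WittScheme.genericFibre 𝒴) (2 * r))) := by
    have : C.bo 𝒴 (2 * r) (N • u) = (N : K(p, k)) • C.bo 𝒴 (2 * r) u := by
      rw [map_zsmul, Int.cast_smul_eq_zsmul]
    rw [← this, hNu, map_add]
    exact Submodule.add_mem _ hbs hv
  have hNK : (N : K(p, k)) ≠ 0 := by exact_mod_cast hN
  exact (Submodule.smul_mem_iff _ hNK).1 hNbo

end Seeds

/-- `stub_anchors ∧ stub_zeroOneSeeds` at one host imply the merged `∃`-form (one genuine, spanning
anchor carrying `{0,1}`-seeds). [folklore] -/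
theorem exists_anchored_of_stubs {n : ℕ} {X : SchemeOver ℂ} (hA : HasGenuineSpanningAnchor n X)
    (hZ : ZeroOneSeedsAtAnchors n X) :
    ∃ D : Anchor n X, D.IsGenuine ∧ D.SpansHodge ∧ ZeroOneSeedsFor D.C n D.𝒴 := by
  obtain ⟨D, hD, hS⟩ := hA
  exact ⟨D, hD, hS, hZ D hD⟩

/-- **TIGHTNESS, forward** (what the seeds force at one anchor): at a genuine, spanning anchor,
`{0,1}`-seeds + engine give the middle cycle part of HC for the host. [folklore] -/
theorem middleCyclePart_of_zeroOneSeedsFor (h1b : PadicPridhamSemiregularity)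
    (h1a : FormalLiftingFromClassLifting) (h3a : FormalVectorBundlesAlgebraize)
    {n : ℕ} {X : SchemeOver ℂ} (D : Anchor n X) (hD : D.IsGenuine) (hS : D.SpansHodge)
    (hZ : ZeroOneSeedsFor D.C n D.𝒴) : MiddleCyclePart n X :=
  D.middleCyclePart_of_rationalPVHCFor hD hS
    (rationalPVHCFor_of_starSeedsFor h1a h3a D.C hD.bek (D.modelHypotheses hD)
      (starSeedsFor_of_zeroOneSeedsFor h1b D.C D.model hZ))

/-- **The merged `∃`-form already gives HC for the host** (granted the engine; smooth projectivity of
`X` comes from the anchor's model, `isSmoothProjective_of_padicModel`, and the Hodge-model conjunct from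
`nonempty_hodgeModel_holds`) — the line's `hodgeConjectureFor_of_anchor` restated so that neither the
`∀` over genuine anchors of `stub_zeroOneSeeds` nor the separate `∃` of `stub_anchors` is needed. At a
tight anchor the converse returns only `RationalPVHCFor`
(`AbelianAnchor.rationalPVHCFor_iff_hodgeConjectureFor`), never the object-level seeds. [folklore] -/
theorem hodgeConjectureFor_of_exists_anchored_zeroOneSeeds (h1b : PadicPridhamSemiregularity)
    (h1a : FormalLiftingFromClassLifting) (h3a : FormalVectorBundlesAlgebraize)
    {n : ℕ} {X : SchemeOver ℂ}
    (h : ∃ D : Anchor n X, D.IsGenuine ∧ D.SpansHodge ∧ ZeroOneSeedsFor D.C n D.𝒴) :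
    HodgeConjectureFor n X := by
  obtain ⟨D, hD, hS, hZ⟩ := h
  exact ⟨nonempty_hodgeModel_holds (isSmoothProjective_of_padicModel D.toPadicModel),
    cyclePart D hD hS (rationalPVHCFor_of_starSeedsFor h1a h3a D.C hD.bek (D.modelHypotheses hD)
      (starSeedsFor_of_zeroOneSeedsFor h1b D.C D.model hZ))⟩

/-- **The merged `∃`-form at the hosts feeds `stub_transfer`**: granted the engine, one anchored seed
statement per power of a Fermat Jacobian gives `HodgeFermatJacobianPowersAt m C 𝒥` for all `m, C, 𝒥`
— the hypothesis of the line's `stub_transfer`. Recommended single open stub of the line: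
`∀ m C 𝒥, IsFermatVariety 1 m C → IsSmoothProjective 1 C → ∀ N, ∃ D : Anchor _ (𝒥.J.powSucc N).X,
D.IsGenuine ∧ D.SpansHodge ∧ ZeroOneSeedsFor D.C _ D.𝒴`. [folklore] -/
theorem hodgeFermatJacobianPowersAt_of_exists_anchored (h1b : PadicPridhamSemiregularity)
    (h1a : FormalLiftingFromClassLifting) (h3a : FormalVectorBundlesAlgebraize)
    (h : ∀ (m : ℕ) (C : SchemeOver ℂ) (𝒥 : Jacobian C), IsFermatVariety 1 m C →
      IsSmoothProjective 1 C → ∀ N : ℕ,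
        ∃ D : Anchor (𝒥.J.powSucc N).dim (𝒥.J.powSucc N).X,
          D.IsGenuine ∧ D.SpansHodge ∧ ZeroOneSeedsFor D.C (𝒥.J.powSucc N).dim D.𝒴) :
    ∀ (m : ℕ) (C : SchemeOver ℂ) (𝒥 : Jacobian C), HodgeFermatJacobianPowersAt m C 𝒥 :=
  fun m C 𝒥 hF hC N => hodgeConjectureFor_of_exists_anchored_zeroOneSeeds h1b h1a h3a (h m C 𝒥 hF hC N)

/-- The registered pair of stubs (statements verbatim) implies the merged `∃`-form at the hosts.
[folklore] -/
theorem exists_anchored_hosts_of_stubs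
    (hA : ∀ (m : ℕ) (C : SchemeOver ℂ) (𝒥 : Jacobian C), IsFermatVariety 1 m C →
      IsSmoothProjective 1 C → ∀ N : ℕ, HasGenuineSpanningAnchor (𝒥.J.powSucc N).dim (𝒥.J.powSucc N).X)
    (hZ : ∀ (m : ℕ) (C : SchemeOver ℂ) (𝒥 : Jacobian C), IsFermatVariety 1 m C →
      IsSmoothProjective 1 C → ∀ N : ℕ, ZeroOneSeedsAtAnchors (𝒥.J.powSucc N).dim (𝒥.J.powSucc N).X) :
    ∀ (m : ℕ) (C : SchemeOver ℂ) (𝒥 : Jacobian C), IsFermatVariety 1 m C →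
      IsSmoothProjective 1 C → ∀ N : ℕ,
        ∃ D : Anchor (𝒥.J.powSucc N).dim (𝒥.J.powSucc N).X,
          D.IsGenuine ∧ D.SpansHodge ∧ ZeroOneSeedsFor D.C (𝒥.J.powSucc N).dim D.𝒴 :=
  fun m C 𝒥 hF hC N => exists_anchored_of_stubs (hA m C 𝒥 hF hC N) (hZ m C 𝒥 hF hC N)

end Summit.HodgeConjecture.HodgeConjecture.Theorems.FermatAnchorAssemblyNegative

end
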